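import Literature.Topology.FourManifolds.BoundaryGlueDataSeam
import Literature.Topology.FourManifolds.CollarReparamCalculus
import Literature.Geometry.Riemannian.EmbeddingPieceMetric
import Literature.Geometry.Lorentzian.MetricValCongr
import HarnessLib

/-!
# Metrics on the pieces and on the seam descend to the three-piece gluing `M ∪_φ N`

Support file (everything proved, no definitions, no named facts) for the τ-equivariant collar
gluing (stub `stub_collarGluing` of crux `CorkRegluablePsc`, item stmt-SmoothPoincare4-3206).
Let `P = G.d₂.Glued` be the three-piece gluing `(M - ∂M) ∪ (∂M × ℝ) ∪ (N - ∂N)` of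
`BoundaryGluingConstruction.lean` (Milnor 1965, proof of Thm. 1.4) and let `g_M`, `g_N`, `g_S` be
smooth metrics on `M`, `N` and on the seam tube `∂M × ℝ` such that **the two collar maps are
isometries**: `(CM)^* g_M = g_S` on `t > 0` and `((z,t) ↦ CN (φ z) (-t))^* g_N = g_S` on
`t < 0`.  Then `P` carries a smooth metric `g` (with Levi-Civita connection) whose pullback to the
tube is `g_S`, which is Riemannian if the three metrics are, and whose scalar curvature at a
point of the interior of `M` / of `N` / of the tube is that of `g_M` / `g_N` / `g_S`
(`exists_threePieceGluedMetric`).  This is the metric half of the gluing of manifolds with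
isometric collars (O'Neill 1983, Ch. 3, pp. 90–91: metrics descend along local diffeomorphisms
which are isometries on overlaps; Bär–Hanke 2023, §3, Cor. 34 and §4.4: doubling / gluing of
`C`-normal metrics), obtained from the two-piece statement
`SmoothGlueData.exists_metric_of_glue_isometry` (`GluedMetric.lean`) applied twice, the interior
metrics `val^* g_M`, `val^* g_N` (`exists_metric_comap_of_injective`) and naturality of the scalar
curvature (`scalarCurvature_comap`, O'Neill 1983, Ch. 3, Prop. 3.59).

## References

* B. O'Neill, *Semi-Riemannian Geometry* (1983), Ch. 3, pp. 90–91 and Prop. 3.59. [ONeill1983]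
* J. Milnor, *Lectures on the h-cobordism theorem* (1965), §1, Thm. 1.4. [MilnorHCobordism1965]
* C. Bär, B. Hanke, *Boundary conditions for scalar curvature* (2023), §3, Cor. 34; §4.4.
  [BarHanke2023]
-/

open scoped Manifold ContDiff Topology
open Set Function Topology

noncomputable section

namespace Literature.Geometry.Riemannian

open Literature.Topology.FourManifolds Literature.Geometry.Lorentzian
  Literature.Geometry.Lorentzian.PseudoRiemannianMetric

universe u

/-- Local notation: `𝔼 n` is the model Euclidean space `EuclideanSpace ℝ (Fin n)`. -/
local notation "𝔼 " n:arg => EuclideanSpace ℝ (Fin n)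
/-- Local notation: `ℍ n` is the model half-space `EuclideanHalfSpace n`. -/
local notation "ℍ " n:arg => EuclideanHalfSpace n
/-- Transport of a fibrewise bilinear form along an equality of base points and of vectors (the
fibres `TangentSpace I x = E` do not depend on the point). [folklore] -/
theorem bilin_congr_point_vec
    {E H : Type*} [NormedAddCommGroup E] [NormedSpace ℝ E] [TopologicalSpace H]
    {I : ModelWithCorners ℝ E H} {M : Type*} [TopologicalSpace M] [ChartedSpace H M]
    (b : ∀ x : M, TangentSpace I x →L[ℝ] TangentSpace I x →L[ℝ] ℝ) {x y : M} (h : x = y)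
    {v w v' w' : E} (hv : v = v') (hw : w = w') : b x v w = b y v' w' := by
  subst h hv hw; rfl

/-- Transport of a differential along an equality of base points (the fibres `TangentSpace I x = E`
do not depend on the point). [folklore] -/
theorem mfderiv_congr_point'
    {E H : Type*} [NormedAddCommGroup E] [NormedSpace ℝ E] [TopologicalSpace H]
    {I : ModelWithCorners ℝ E H} {M : Type*} [TopologicalSpace M] [ChartedSpace H M]
    {E' H' : Type*} [NormedAddCommGroup E'] [NormedSpace ℝ E'] [TopologicalSpace H']
    {I' : ModelWithCorners ℝ E' H'} {M' : Type*} [TopologicalSpace M'] [ChartedSpace H' M']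
    (f : M → M') {x y : M} (h : x = y) (v : E) : mfderiv I I' f x v = mfderiv I I' f y v := by
  subst h; rfl

section ThreePiece

variable {n : ℕ} {M N : Type u}
  [TopologicalSpace M] [ChartedSpace (ℍ (n + 1)) M] [TopologicalSpace N] [ChartedSpace (ℍ (n + 1)) N]
  {bM : BoundaryData (𝓡∂ (n + 1)) M (𝓡 n)} {bN : BoundaryData (𝓡∂ (n + 1)) N (𝓡 n)}
  (G : BoundaryGlueData bM bN) [IsManifold (𝓡∂ (n + 1)) ∞ M] [Nonempty bM.carrier]
  [IsManifold (𝓡∂ (n + 1)) ∞ N]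

omit [Nonempty bM.carrier] [IsManifold (𝓡∂ (n + 1)) ∞ N] in
/-- **The collar of `M` is an isometry for the interior metric `val^* g_M`** (first gluing
relation of the three-piece gluing): if `(CM)^* g_M = g_S` on `t > 0` then the gluing map
`glueHomeo : ∂M × (0, ∞) → M - ∂M` of `d₁` satisfies `glue^* (val^* g_M) = g_S` (chain rule).
[cite: ONeill1983, Ch. 3, p. 58] -/
theorem glue₁_isometry_of_collar
    (gM : PseudoRiemannianMetric (𝓡∂ (n + 1)) ∞ (𝔼 (n + 1)) (TangentSpace (𝓡∂ (n + 1)) : M → Type _))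
    (gS : PseudoRiemannianMetric ((𝓡 n).prod 𝓘(ℝ, ℝ)) ∞ (𝔼 n × ℝ)
      (TangentSpace ((𝓡 n).prod 𝓘(ℝ, ℝ)) : bM.carrier × ℝ → Type _))
    (gIM : PseudoRiemannianMetric 𝓘(ℝ, 𝔼 (n + 1)) ∞ (𝔼 (n + 1))
      (TangentSpace 𝓘(ℝ, 𝔼 (n + 1)) : InteriorManifold (𝓡∂ (n + 1)) M → Type _))
    (hIMval : ∀ (u : InteriorManifold (𝓡∂ (n + 1)) M) (v w : TangentSpace 𝓘(ℝ, 𝔼 (n + 1)) u),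
      gIM.val u v w = gM.val u.val
        (mfderiv 𝓘(ℝ, 𝔼 (n + 1)) (𝓡∂ (n + 1)) InteriorManifold.val u v)
        (mfderiv 𝓘(ℝ, 𝔼 (n + 1)) (𝓡∂ (n + 1)) InteriorManifold.val u w))
    (hM : ∀ p : bM.carrier × ℝ, 0 < p.2 → ∀ v w : TangentSpace ((𝓡 n).prod 𝓘(ℝ, ℝ)) p,
      gM.val (G.CM.inPt p).val
        (mfderiv ((𝓡 n).prod 𝓘(ℝ, ℝ)) (𝓡∂ (n + 1)) (InteriorManifold.val ∘ G.CM.inPt) p v)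
        (mfderiv ((𝓡 n).prod 𝓘(ℝ, ℝ)) (𝓡∂ (n + 1)) (InteriorManifold.val ∘ G.CM.inPt) p w) =
      gS.val p v w) :
    ∀ p ∈ G.d₁.glue.source, ∀ v w : TangentSpace ((𝓡 n).prod 𝓘(ℝ, ℝ)) p,
      gIM.val (G.d₁.glue p) (mfderiv ((𝓡 n).prod 𝓘(ℝ, ℝ)) 𝓘(ℝ, 𝔼 (n + 1)) G.d₁.glue p v)
        (mfderiv ((𝓡 n).prod 𝓘(ℝ, ℝ)) 𝓘(ℝ, 𝔼 (n + 1)) G.d₁.glue p w) = gS.val p v w := by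
  have hvalM : MDifferentiable 𝓘(ℝ, 𝔼 (n + 1)) (𝓡∂ (n + 1))
      (InteriorManifold.val : InteriorManifold (𝓡∂ (n + 1)) M → M) :=
    InteriorManifold.contMDiff_val.mdifferentiable (by simp)
  intro p hp v w
  have hp' : 0 < p.2 := hp
  have hglue : MDifferentiableAt ((𝓡 n).prod 𝓘(ℝ, ℝ)) 𝓘(ℝ, 𝔼 (n + 1)) G.d₁.glue p :=
    (G.d₁.contMDiffOn_glue.contMDiffAt (G.d₁.glue.open_source.mem_nhds hp)).mdifferentiableAt
      (by simp)
  have hcomp : mfderiv ((𝓡 n).prod 𝓘(ℝ, ℝ)) (𝓡∂ (n + 1)) (InteriorManifold.val ∘ G.CM.inPt) p =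
      (mfderiv 𝓘(ℝ, 𝔼 (n + 1)) (𝓡∂ (n + 1)) InteriorManifold.val (G.d₁.glue p)).comp
        (mfderiv ((𝓡 n).prod 𝓘(ℝ, ℝ)) 𝓘(ℝ, 𝔼 (n + 1)) G.d₁.glue p) :=
    mfderiv_comp p (hvalM _) hglue
  rw [hIMval, ← hM p hp' v w, hcomp]
  rfl

set_option maxHeartbeats 400000 in
/-- **The re-indexed collar of `N` is an isometry for the interior metric `val^* g_N`** (second
gluing relation): if `((z, t) ↦ CN (φ z) (-t))^* g_N = g_S` on `t < 0` and the first glued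
metric `g₁` on `X = (∂M × ℝ) ∪ (M - ∂M)` restricts to `g_S` on the tube, then the second gluing
map `glue₂` satisfies `glue₂^* (val^* g_N) = g₁` on its source (chain rule). [cite: ONeill1983, Ch. 3, p. 58] -/
theorem glue₂_isometry_of_collar
    (gN : PseudoRiemannianMetric (𝓡∂ (n + 1)) ∞ (𝔼 (n + 1)) (TangentSpace (𝓡∂ (n + 1)) : N → Type _))
    (gS : PseudoRiemannianMetric ((𝓡 n).prod 𝓘(ℝ, ℝ)) ∞ (𝔼 n × ℝ)
      (TangentSpace ((𝓡 n).prod 𝓘(ℝ, ℝ)) : bM.carrier × ℝ → Type _))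
    (gIN : PseudoRiemannianMetric 𝓘(ℝ, 𝔼 (n + 1)) ∞ (𝔼 (n + 1))
      (TangentSpace 𝓘(ℝ, 𝔼 (n + 1)) : InteriorManifold (𝓡∂ (n + 1)) N → Type _))
    (hINval : ∀ (u : InteriorManifold (𝓡∂ (n + 1)) N) (v w : TangentSpace 𝓘(ℝ, 𝔼 (n + 1)) u),
      gIN.val u v w = gN.val u.val
        (mfderiv 𝓘(ℝ, 𝔼 (n + 1)) (𝓡∂ (n + 1)) InteriorManifold.val u v)
        (mfderiv 𝓘(ℝ, 𝔼 (n + 1)) (𝓡∂ (n + 1)) InteriorManifold.val u w))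
    (g₁ : PseudoRiemannianMetric 𝓘(ℝ, 𝔼 (n + 1)) ∞ (𝔼 (n + 1))
      (TangentSpace 𝓘(ℝ, 𝔼 (n + 1)) : G.d₁.Glued → Type _))
    (hA₁ : ∀ (a : bM.carrier × ℝ) (v w : TangentSpace ((𝓡 n).prod 𝓘(ℝ, ℝ)) a),
      g₁.val (G.d₁.inl a) (mfderiv ((𝓡 n).prod 𝓘(ℝ, ℝ)) 𝓘(ℝ, 𝔼 (n + 1)) G.d₁.inl a v)
        (mfderiv ((𝓡 n).prod 𝓘(ℝ, ℝ)) 𝓘(ℝ, 𝔼 (n + 1)) G.d₁.inl a w) = gS.val a v w)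
    (hN : ∀ p : bM.carrier × ℝ, p.2 < 0 → ∀ v w : TangentSpace ((𝓡 n).prod 𝓘(ℝ, ℝ)) p,
      gN.val (G.CN.inPt (G.φ p.1, -p.2)).val
        (mfderiv ((𝓡 n).prod 𝓘(ℝ, ℝ)) (𝓡∂ (n + 1))
          (fun q : bM.carrier × ℝ ↦ (G.CN.inPt (G.φ q.1, -q.2)).val) p v)
        (mfderiv ((𝓡 n).prod 𝓘(ℝ, ℝ)) (𝓡∂ (n + 1))
          (fun q : bM.carrier × ℝ ↦ (G.CN.inPt (G.φ q.1, -q.2)).val) p w) =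
      gS.val p v w) :
    ∀ x ∈ G.d₂.glue.source, ∀ v w : TangentSpace 𝓘(ℝ, 𝔼 (n + 1)) x,
      gIN.val (G.d₂.glue x) (mfderiv 𝓘(ℝ, 𝔼 (n + 1)) 𝓘(ℝ, 𝔼 (n + 1)) G.d₂.glue x v)
        (mfderiv 𝓘(ℝ, 𝔼 (n + 1)) 𝓘(ℝ, 𝔼 (n + 1)) G.d₂.glue x w) = g₁.val x v w := by
  have hvalN : MDifferentiable 𝓘(ℝ, 𝔼 (n + 1)) (𝓡∂ (n + 1))
      (InteriorManifold.val : InteriorManifold (𝓡∂ (n + 1)) N → N) :=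
    InteriorManifold.contMDiff_val.mdifferentiable (by simp)
  intro x hx v w
  obtain ⟨p, hp, rfl⟩ := G.mem_glue₂_source_iff.1 hx
  obtain ⟨v', rfl⟩ := (G.d₁.mfderiv_inl_bijective p).2 v
  obtain ⟨w', rfl⟩ := (G.d₁.mfderiv_inl_bijective p).2 w
  rw [hA₁ p v' w']
  have hglue : MDifferentiableAt 𝓘(ℝ, 𝔼 (n + 1)) 𝓘(ℝ, 𝔼 (n + 1)) G.d₂.glue (G.d₁.inl p) :=
    (G.d₂.contMDiffOn_glue.contMDiffAt (G.d₂.glue.open_source.mem_nhds hx)).mdifferentiableAt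
      (by simp)
  have hinl : MDifferentiableAt ((𝓡 n).prod 𝓘(ℝ, ℝ)) 𝓘(ℝ, 𝔼 (n + 1)) G.d₁.inl p :=
    G.d₁.contMDiff_inl.mdifferentiableAt (by simp)
  -- `glue₂ ∘ inl = (q ↦ CN (φ q₁) (-q₂))`
  have hfun : (G.d₂.glue ∘ G.d₁.inl) = fun q : bM.carrier × ℝ ↦ G.CN.inPt (G.φ q.1, -q.2) :=
    funext fun q ↦ G.glue₂_inl q
  have hc1 : ∀ u : TangentSpace ((𝓡 n).prod 𝓘(ℝ, ℝ)) p,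
      mfderiv 𝓘(ℝ, 𝔼 (n + 1)) 𝓘(ℝ, 𝔼 (n + 1)) G.d₂.glue (G.d₁.inl p)
        (mfderiv ((𝓡 n).prod 𝓘(ℝ, ℝ)) 𝓘(ℝ, 𝔼 (n + 1)) G.d₁.inl p u) =
      mfderiv ((𝓡 n).prod 𝓘(ℝ, ℝ)) 𝓘(ℝ, 𝔼 (n + 1))
        (fun q : bM.carrier × ℝ ↦ G.CN.inPt (G.φ q.1, -q.2)) p u := fun u ↦ by
    rw [← hfun, mfderiv_comp p hglue hinl]
    rfl
  have hgd : MDifferentiableAt ((𝓡 n).prod 𝓘(ℝ, ℝ)) 𝓘(ℝ, 𝔼 (n + 1))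
      (fun q : bM.carrier × ℝ ↦ G.CN.inPt (G.φ q.1, -q.2)) p := by
    rw [← hfun]
    exact hglue.comp p hinl
  have hc2 : ∀ u : TangentSpace ((𝓡 n).prod 𝓘(ℝ, ℝ)) p,
      mfderiv 𝓘(ℝ, 𝔼 (n + 1)) (𝓡∂ (n + 1)) InteriorManifold.val (G.CN.inPt (G.φ p.1, -p.2))
        (mfderiv ((𝓡 n).prod 𝓘(ℝ, ℝ)) 𝓘(ℝ, 𝔼 (n + 1))
          (fun q : bM.carrier × ℝ ↦ G.CN.inPt (G.φ q.1, -q.2)) p u) =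
      mfderiv ((𝓡 n).prod 𝓘(ℝ, ℝ)) (𝓡∂ (n + 1))
        (fun q : bM.carrier × ℝ ↦ (G.CN.inPt (G.φ q.1, -q.2)).val) p u := fun u ↦ by
    have h := mfderiv_comp p (hvalN _) hgd
    rw [show (fun q : bM.carrier × ℝ ↦ (G.CN.inPt (G.φ q.1, -q.2)).val) =
      InteriorManifold.val ∘ (fun q : bM.carrier × ℝ ↦ G.CN.inPt (G.φ q.1, -q.2)) from rfl, h]
    rfl
  have hbase : G.d₂.glue (G.d₁.inl p) = G.CN.inPt (G.φ p.1, -p.2) := G.glue₂_inl p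
  have hvec : ∀ u : TangentSpace ((𝓡 n).prod 𝓘(ℝ, ℝ)) p,
      mfderiv 𝓘(ℝ, 𝔼 (n + 1)) (𝓡∂ (n + 1)) InteriorManifold.val (G.d₂.glue (G.d₁.inl p))
        (mfderiv 𝓘(ℝ, 𝔼 (n + 1)) 𝓘(ℝ, 𝔼 (n + 1)) G.d₂.glue (G.d₁.inl p)
          (mfderiv ((𝓡 n).prod 𝓘(ℝ, ℝ)) 𝓘(ℝ, 𝔼 (n + 1)) G.d₁.inl p u)) =
      mfderiv ((𝓡 n).prod 𝓘(ℝ, ℝ)) (𝓡∂ (n + 1))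
        (fun q : bM.carrier × ℝ ↦ (G.CN.inPt (G.φ q.1, -q.2)).val) p u := fun u ↦ by
    have e1 := DFunLike.congr_arg
      (mfderiv 𝓘(ℝ, 𝔼 (n + 1)) (𝓡∂ (n + 1)) InteriorManifold.val (G.d₂.glue (G.d₁.inl p)))
      (hc1 u)
    exact e1.trans ((mfderiv_congr_point' InteriorManifold.val hbase _).trans (hc2 u))
  rw [hINval, ← hN p hp v' w']
  exact bilin_congr_point_vec gN.val (congrArg InteriorManifold.val hbase) (hvec v') (hvec w')

set_option maxHeartbeats 1600000 in
/-- **Metrics with isometric collars descend to the three-piece gluing.** Let `g_M`, `g_N` be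
smooth metrics on `M`, `N` and `g_S` a smooth metric on the seam tube `∂M × ℝ` such that the
collar of `M` is an isometry `(∂M × (0, ∞), g_S) → (M, g_M)` and the re-indexed collar of `N`,
`(z, t) ↦ CN (φ z) (-t)`, is an isometry `(∂M × (-∞, 0), g_S) → (N, g_N)`.  Then the glued
manifold `P = G.d₂.Glued` carries a smooth metric `g` with Levi-Civita connection such that:
the tube `p ↦ inl (inl p)` is an isometry from `g_S`; `g` is Riemannian if `g_M`, `g_N`, `g_S`
are; and the scalar curvature of `g` at `inl (inr a)`, `inr b`, `inl (inl p)` is that of `g_M` at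
`a`, of `g_N` at `b`, of `g_S` at `p` (O'Neill 1983, Ch. 3, pp. 90–91 and Prop. 3.59).
[cite: ONeill1983, Ch. 3, pp. 90–91 and Prop. 3.59] -/
theorem exists_threePieceGluedMetric
    (gM : PseudoRiemannianMetric (𝓡∂ (n + 1)) ∞ (𝔼 (n + 1)) (TangentSpace (𝓡∂ (n + 1)) : M → Type _))
    [gM.HasLeviCivita]
    (gN : PseudoRiemannianMetric (𝓡∂ (n + 1)) ∞ (𝔼 (n + 1)) (TangentSpace (𝓡∂ (n + 1)) : N → Type _))
    [gN.HasLeviCivita]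
    (gS : PseudoRiemannianMetric ((𝓡 n).prod 𝓘(ℝ, ℝ)) ∞ (𝔼 n × ℝ)
      (TangentSpace ((𝓡 n).prod 𝓘(ℝ, ℝ)) : bM.carrier × ℝ → Type _)) [gS.HasLeviCivita]
    (hM : ∀ p : bM.carrier × ℝ, 0 < p.2 → ∀ v w : TangentSpace ((𝓡 n).prod 𝓘(ℝ, ℝ)) p,
      gM.val (G.CM.inPt p).val
        (mfderiv ((𝓡 n).prod 𝓘(ℝ, ℝ)) (𝓡∂ (n + 1)) (InteriorManifold.val ∘ G.CM.inPt) p v)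
        (mfderiv ((𝓡 n).prod 𝓘(ℝ, ℝ)) (𝓡∂ (n + 1)) (InteriorManifold.val ∘ G.CM.inPt) p w) =
      gS.val p v w)
    (hN : ∀ p : bM.carrier × ℝ, p.2 < 0 → ∀ v w : TangentSpace ((𝓡 n).prod 𝓘(ℝ, ℝ)) p,
      gN.val (G.CN.inPt (G.φ p.1, -p.2)).val
        (mfderiv ((𝓡 n).prod 𝓘(ℝ, ℝ)) (𝓡∂ (n + 1))
          (fun q : bM.carrier × ℝ ↦ (G.CN.inPt (G.φ q.1, -q.2)).val) p v)
        (mfderiv ((𝓡 n).prod 𝓘(ℝ, ℝ)) (𝓡∂ (n + 1))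
          (fun q : bM.carrier × ℝ ↦ (G.CN.inPt (G.φ q.1, -q.2)).val) p w) =
      gS.val p v w) :
    ∃ g : PseudoRiemannianMetric 𝓘(ℝ, 𝔼 (n + 1)) ∞ (𝔼 (n + 1))
        (TangentSpace 𝓘(ℝ, 𝔼 (n + 1)) : G.d₂.Glued → Type _), ∃ _ : g.HasLeviCivita,
      (∀ (p : bM.carrier × ℝ) (v w : TangentSpace ((𝓡 n).prod 𝓘(ℝ, ℝ)) p),
        g.val (G.d₂.inl (G.d₁.inl p))
          (mfderiv ((𝓡 n).prod 𝓘(ℝ, ℝ)) 𝓘(ℝ, 𝔼 (n + 1)) (G.d₂.inl ∘ G.d₁.inl) p v)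
          (mfderiv ((𝓡 n).prod 𝓘(ℝ, ℝ)) 𝓘(ℝ, 𝔼 (n + 1)) (G.d₂.inl ∘ G.d₁.inl) p w) =
        gS.val p v w) ∧
      (gM.IsRiemannian → gN.IsRiemannian → gS.IsRiemannian → g.IsRiemannian) ∧
      (∀ a, g.scalarCurvature (G.d₂.inl (G.d₁.inr a)) = gM.scalarCurvature a.val) ∧
      (∀ b, g.scalarCurvature (G.d₂.inr b) = gN.scalarCurvature b.val) ∧
      (∀ p, g.scalarCurvature (G.d₂.inl (G.d₁.inl p)) = gS.scalarCurvature p) := by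
  -- the interior metrics `val^* gM`, `val^* gN`
  obtain ⟨gIM, hIMlc, hIMval, hIMr, hIMs⟩ := exists_metric_comap_of_injective
    (InteriorManifold.contMDiff_val (I := 𝓡∂ (n + 1)) (M := M))
    (fun a ↦ injective_mfderiv_interiorVal a) gM
  obtain ⟨gIN, hINlc, hINval, hINr, hINs⟩ := exists_metric_comap_of_injective
    (InteriorManifold.contMDiff_val (I := 𝓡∂ (n + 1)) (M := N))
    (fun a ↦ injective_mfderiv_interiorVal a) gN
  have hiso₁ := glue₁_isometry_of_collar G gM gS gIM hIMval hM
  obtain ⟨g₁, hA₁, hB₁⟩ := G.d₁.exists_metric_of_glue_isometry gS gIM hiso₁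
  -- second gluing: `X = d₁.Glued` and interior of `N`
  have hiso₂ := glue₂_isometry_of_collar G gN gS gIN hINval g₁ hA₁ hN
  obtain ⟨g, hA₂, hB₂⟩ := G.d₂.exists_metric_of_glue_isometry g₁ gIN hiso₂
  haveI hglc : g.HasLeviCivita := g.hasLeviCivita
  -- the tube isometry
  have htube : ∀ (p : bM.carrier × ℝ) (v w : TangentSpace ((𝓡 n).prod 𝓘(ℝ, ℝ)) p),
      g.val (G.d₂.inl (G.d₁.inl p))
        (mfderiv ((𝓡 n).prod 𝓘(ℝ, ℝ)) 𝓘(ℝ, 𝔼 (n + 1)) (G.d₂.inl ∘ G.d₁.inl) p v)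
        (mfderiv ((𝓡 n).prod 𝓘(ℝ, ℝ)) 𝓘(ℝ, 𝔼 (n + 1)) (G.d₂.inl ∘ G.d₁.inl) p w) =
      gS.val p v w := fun p v w ↦ by
    rw [mfderiv_comp p (G.d₂.contMDiff_inl.mdifferentiableAt (by simp))
      (G.d₁.contMDiff_inl.mdifferentiableAt (by simp))]
    show g.val (G.d₂.inl (G.d₁.inl p)) (mfderiv _ _ G.d₂.inl _ (mfderiv _ _ G.d₁.inl p v))
      (mfderiv _ _ G.d₂.inl _ (mfderiv _ _ G.d₁.inl p w)) = _
    rw [hA₂, hA₁]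
  -- the interior-of-`M` isometry
  have hintM : ∀ (a : InteriorManifold (𝓡∂ (n + 1)) M) (v w : TangentSpace 𝓘(ℝ, 𝔼 (n + 1)) a),
      g.val (G.d₂.inl (G.d₁.inr a))
        (mfderiv 𝓘(ℝ, 𝔼 (n + 1)) 𝓘(ℝ, 𝔼 (n + 1)) (G.d₂.inl ∘ G.d₁.inr) a v)
        (mfderiv 𝓘(ℝ, 𝔼 (n + 1)) 𝓘(ℝ, 𝔼 (n + 1)) (G.d₂.inl ∘ G.d₁.inr) a w) =
      gIM.val a v w := fun a v w ↦ by
    rw [mfderiv_comp a (G.d₂.contMDiff_inl.mdifferentiableAt (by simp))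
      (G.d₁.contMDiff_inr.mdifferentiableAt (by simp))]
    show g.val (G.d₂.inl (G.d₁.inr a)) (mfderiv _ _ G.d₂.inl _ (mfderiv _ _ G.d₁.inr a v))
      (mfderiv _ _ G.d₂.inl _ (mfderiv _ _ G.d₁.inr a w)) = _
    rw [hA₂, hB₁]
  refine ⟨g, hglc, htube, fun hgM hgN hgS ↦ ?_, fun a ↦ ?_, fun b ↦ ?_, fun p ↦ ?_⟩
  · -- Riemannian
    exact G.d₂.isRiemannian_of_glue g₁ gIN g hA₂ hB₂
      (G.d₁.isRiemannian_of_glue gS gIM g₁ hA₁ hB₁ hgS (hIMr hgM)) (hINr hgN)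
  · -- scalar curvature at interior points of `M`
    obtain ⟨gQ, hQlc, hQval, -, hQs⟩ := exists_metric_comap_of_injective
      (Ψ := G.d₂.inl ∘ G.d₁.inr) (G.d₂.contMDiff_inl.comp G.d₁.contMDiff_inr)
      (G.injective_mfderiv_inl_inr) g
    have hv : ∀ x, gQ.val x = gIM.val x := fun x ↦ by
      ext v w
      rw [hQval]
      exact hintM x v w
    rw [← hIMs a, ← scalarCurvature_congr_of_val_eq hv a, hQs a]
    rfl
  · -- scalar curvature at interior points of `N`
    obtain ⟨gQ, hQlc, hQval, -, hQs⟩ := exists_metric_comap_of_injective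
      G.d₂.contMDiff_inr (fun b ↦ (G.d₂.mfderiv_inr_bijective b).1) g
    have hv : ∀ x, gQ.val x = gIN.val x := fun x ↦ by
      ext v w
      rw [hQval]
      exact hB₂ x v w
    rw [← hINs b, ← scalarCurvature_congr_of_val_eq hv b, hQs b]
  · -- scalar curvature on the tube (different model vector space: `scalarCurvature_comap`)
    have h1 : ContMDiff ((𝓡 n).prod 𝓘(ℝ, ℝ)) 𝓘(ℝ, 𝔼 (n + 1)) (∞ + 1) (G.d₂.inl ∘ G.d₁.inl) := by
      have h : ((∞ : ℕ∞ω) + 1) = ∞ := rfl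
      rw [h]
      exact G.contMDiff_inl_inl
    have hinj : ∀ p, Injective (mfderiv ((𝓡 n).prod 𝓘(ℝ, ℝ)) 𝓘(ℝ, 𝔼 (n + 1))
        (G.d₂.inl ∘ G.d₁.inl) p) := fun p ↦ (G.bijective_mfderiv_inl_inl p).1
    have hdim : Module.finrank ℝ (𝔼 n × ℝ) = Module.finrank ℝ (𝔼 (n + 1)) := by
      rw [Module.finrank_prod, Module.finrank_self, finrank_euclideanSpace_fin,
        finrank_euclideanSpace_fin]
    set gQ := g.comap contMDiff_pullbackBilin_holds (G.d₂.inl ∘ G.d₁.inl) h1 hinj hdim with hgQ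
    haveI hQlc : gQ.HasLeviCivita := gQ.hasLeviCivita
    have hv : ∀ x, gQ.val x = gS.val x := fun x ↦ by
      ext v w
      rw [hgQ, val_comap, pullbackBilin_apply]
      exact htube x v w
    rw [← scalarCurvature_congr_of_val_eq hv p]
    exact (g.scalarCurvature_comap contMDiff_pullbackBilin_holds h1 hinj hdim p).symm

end ThreePiece

end Literature.Geometry.Riemannian
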